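import Summits.HodgeConjecture.HodgeConjecture.Theorems.R90S6GLThreePieriCounts   -- L3 FILE 2: the closed forms `ncard_pieri_one_eq`, `ncard_pieri_two_eq`
import HarnessLib

/-!
# R90 · S6 — card L3, FILE 3: the GL₃ Pieri tables in `μ`-centric form (`λ = μ + vertical strip`) and the vanishing off the strips

Seat `R90-C14-p10 (g0)`, helper for `stmt-HodgeConjecture-24833` (h413); the consumer-ready corollaries of FILE 2's closed forms for
R90-C14-p06's (H.1)/(H.2) «`c_μ·T_r = Σ_{λ = μ + vertical r-strip} pieriCount r μ λ • c_λ`» (junction letter of FILE 1, no new definition):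
for antitone `μ : Fin 3 → ℤ` (`q = #𝓀`, `e_i = Pi.single i 1`)

* `r = 1`: `λ = μ+e₀ ↦ 1`; `λ = μ+e₁` (`μ₁+1 ≤ μ₀`) `↦ q + [μ₀ = μ₁+1]`; `λ = μ+e₂` (`μ₂+1 ≤ μ₁`) `↦ q² + [μ₁ = μ₂+1]·q + [μ₀ = μ₁ = μ₂+1]`;
  every other antitone `λ ↦ 0` (`ncard_pieri_one_eq_zero`);
* `r = 2`: `λ = μ+e₀+e₁ ↦ 1`; `λ = μ+e₀+e₂` (`μ₂+1 ≤ μ₁`) `↦ q + [μ₁ = μ₂+1]`; `λ = μ+e₁+e₂` (`μ₁+1 ≤ μ₀`) `↦ q² + [μ₀ = μ₁+1]·q + [μ₀ = μ₁+1 ∧ μ₁ = μ₂]`;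
  every other antitone `λ ↦ 0` (`ncard_pieri_two_eq_zero`).

Kill-checks (dealer l.6880, `μ = (1,0,0)`): `λ = (2,0,0) ↦ 1`, `(1,1,0) ↦ q+1` (`T₁·T₁ = c_{(2,0,0)} + (q+1)c_{(1,1,0)}`); `λ = (2,1,0) ↦ 1`,
`(1,1,1) ↦ q²+q+1` (`T₁·T₂ = c_{(2,1,0)} + (q²+q+1)c_{(1,1,1)}`).

## References
* [Macdonald1995] I. G. Macdonald, *Symmetric Functions and Hall Polynomials*, 2nd ed. (1995), Ch. II (4.2)–(4.6) (PDF p. 164), Ch. V (2.6).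
-/

set_option autoImplicit false
-- the mandated namespace repeats the single-problem summit's segment (`HodgeConjecture.HodgeConjecture`)
set_option linter.dupNamespace false

noncomputable section

open scoped MatrixGroups
open MulAction ValuativeRel Matrix Finset Literature.NumberTheory.Automorphic Literature.NumberTheory.Automorphic.Echelon
  Literature.LinearAlgebra.Matrix.Echelon

namespace Summit.HodgeConjecture.HodgeConjecture.R90.S6

/-! ## §3 The `μ`-centric tables (`λ = μ + vertical strip`) and the vanishing off the strips -/

section Tables

variable {K : Type*} [Field K] [ValuativeRel K] [IsDiscreteValuationRing 𝒪[K]] [Finite 𝓀[K]] {ϖ : K}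

/-- `c_μ·T₁ ∋ c_{μ+e₀}` with coefficient `1`. [cite: Macdonald1995, Ch. II (4.6); Ch. V (2.6)] -/
theorem ncard_pieri_one_add_single_zero (hϖ : IsUniformizingElement ϖ) {μ : Fin 3 → ℤ} (hμ : Antitone μ) :
    {γ ∈ MulAction.orbit (glInt 3 K) (((heckeDiag 3 (Units.mk0 ϖ hϖ.ne_zero) 1 : GL (Fin 3) K)) : GL (Fin 3) K ⧸ glInt 3 K) |
        ((((γ.out)⁻¹ * zpowDiagGL hϖ.ne_zero (μ + Pi.single 0 1) : GL (Fin 3) K)) : GL (Fin 3) K ⧸ glInt 3 K) ∈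
          MulAction.orbit (glInt 3 K) (((zpowDiagGL hϖ.ne_zero μ : GL (Fin 3) K)) : GL (Fin 3) K ⧸ glInt 3 K)}.ncard = 1 := by
  classical
  have hm := antitone_fin_three_iff.1 hμ
  have hlam : Antitone (μ + Pi.single 0 1 : Fin 3 → ℤ) := antitone_fin_three_iff.2 (by simp; omega)
  rw [ncard_pieri_one_eq hϖ hlam hμ]
  simp only [eq_sub_single_two_iff, eq_sub_single_one_iff, eq_sub_single_zero_iff, Pi.add_apply, Pi.single_apply]
  simp

/-- `c_μ·T₁ ∋ c_{μ+e₁}` (`μ₁ + 1 ≤ μ₀`) with coefficient `q + [μ₀ = μ₁+1]` (`q` if `a > b+1`, `q+1` if `a = b+1`, for `μ = (a,b,c)`).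
[cite: Macdonald1995, Ch. II (4.6); Ch. V (2.6)] -/
theorem ncard_pieri_one_add_single_one (hϖ : IsUniformizingElement ϖ) {μ : Fin 3 → ℤ} (hμ : Antitone μ) (h : μ 1 + 1 ≤ μ 0) :
    {γ ∈ MulAction.orbit (glInt 3 K) (((heckeDiag 3 (Units.mk0 ϖ hϖ.ne_zero) 1 : GL (Fin 3) K)) : GL (Fin 3) K ⧸ glInt 3 K) |
        ((((γ.out)⁻¹ * zpowDiagGL hϖ.ne_zero (μ + Pi.single 1 1) : GL (Fin 3) K)) : GL (Fin 3) K ⧸ glInt 3 K) ∈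
          MulAction.orbit (glInt 3 K) (((zpowDiagGL hϖ.ne_zero μ : GL (Fin 3) K)) : GL (Fin 3) K ⧸ glInt 3 K)}.ncard =
      Nat.card 𝓀[K] + (if μ 0 = μ 1 + 1 then 1 else 0) := by
  classical
  have hm := antitone_fin_three_iff.1 hμ
  have hlam : Antitone (μ + Pi.single 1 1 : Fin 3 → ℤ) := antitone_fin_three_iff.2 (by simp; omega)
  rw [ncard_pieri_one_eq hϖ hlam hμ]
  simp only [eq_sub_single_two_iff, eq_sub_single_one_iff, eq_sub_single_zero_iff, Pi.add_apply, Pi.single_apply]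
  simp

/-- `c_μ·T₁ ∋ c_{μ+e₂}` (`μ₂ + 1 ≤ μ₁`) with coefficient `q² + [μ₁ = μ₂+1]·q + [μ₀ = μ₁ = μ₂+1]` (`q², q²+q, q²+q+1`).
[cite: Macdonald1995, Ch. II (4.6); Ch. V (2.6)] -/
theorem ncard_pieri_one_add_single_two (hϖ : IsUniformizingElement ϖ) {μ : Fin 3 → ℤ} (hμ : Antitone μ) (h : μ 2 + 1 ≤ μ 1) :
    {γ ∈ MulAction.orbit (glInt 3 K) (((heckeDiag 3 (Units.mk0 ϖ hϖ.ne_zero) 1 : GL (Fin 3) K)) : GL (Fin 3) K ⧸ glInt 3 K) |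
        ((((γ.out)⁻¹ * zpowDiagGL hϖ.ne_zero (μ + Pi.single 2 1) : GL (Fin 3) K)) : GL (Fin 3) K ⧸ glInt 3 K) ∈
          MulAction.orbit (glInt 3 K) (((zpowDiagGL hϖ.ne_zero μ : GL (Fin 3) K)) : GL (Fin 3) K ⧸ glInt 3 K)}.ncard =
      Nat.card 𝓀[K] ^ 2 + (if μ 1 = μ 2 + 1 then Nat.card 𝓀[K] else 0) + (if μ 0 = μ 1 ∧ μ 1 = μ 2 + 1 then 1 else 0) := by
  classical
  have hm := antitone_fin_three_iff.1 hμ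
  have hlam : Antitone (μ + Pi.single 2 1 : Fin 3 → ℤ) := antitone_fin_three_iff.2 (by simp; omega)
  rw [ncard_pieri_one_eq hϖ hlam hμ]
  simp only [eq_sub_single_two_iff, eq_sub_single_one_iff, eq_sub_single_zero_iff, Pi.add_apply, Pi.single_apply]
  simp

/-- **VANISHING, `r = 1`**: for antitone `λ ∉ {μ+e₀, μ+e₁, μ+e₂}` the coefficient of `c_λ` in `c_μ·T₁` is `0`. [cite: Macdonald1995, Ch. II (4.4)–(4.6)] -/
theorem ncard_pieri_one_eq_zero (hϖ : IsUniformizingElement ϖ) {lam μ : Fin 3 → ℤ} (hlam : Antitone lam) (hμ : Antitone μ)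
    (h0 : lam ≠ μ + Pi.single 0 1) (h1 : lam ≠ μ + Pi.single 1 1) (h2 : lam ≠ μ + Pi.single 2 1) :
    {γ ∈ MulAction.orbit (glInt 3 K) (((heckeDiag 3 (Units.mk0 ϖ hϖ.ne_zero) 1 : GL (Fin 3) K)) : GL (Fin 3) K ⧸ glInt 3 K) |
        ((((γ.out)⁻¹ * zpowDiagGL hϖ.ne_zero lam : GL (Fin 3) K)) : GL (Fin 3) K ⧸ glInt 3 K) ∈
          MulAction.orbit (glInt 3 K) (((zpowDiagGL hϖ.ne_zero μ : GL (Fin 3) K)) : GL (Fin 3) K ⧸ glInt 3 K)}.ncard = 0 := by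
  classical
  rw [ncard_pieri_one_eq hϖ hlam hμ, if_neg (fun h => h2 (by rw [h, sub_add_cancel])), if_neg (fun h => h1 (by rw [h, sub_add_cancel])),
    if_neg (fun h => h0 (by rw [h, sub_add_cancel]))]

/-- `c_μ·T₂ ∋ c_{μ+e₀+e₁}` with coefficient `1`. [cite: Macdonald1995, Ch. II (4.6); Ch. V (2.6)] -/
theorem ncard_pieri_two_add_single_zero_one (hϖ : IsUniformizingElement ϖ) {μ : Fin 3 → ℤ} (hμ : Antitone μ) :
    {γ ∈ MulAction.orbit (glInt 3 K) (((heckeDiag 3 (Units.mk0 ϖ hϖ.ne_zero) 2 : GL (Fin 3) K)) : GL (Fin 3) K ⧸ glInt 3 K) |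
        ((((γ.out)⁻¹ * zpowDiagGL hϖ.ne_zero (μ + Pi.single 0 1 + Pi.single 1 1) : GL (Fin 3) K)) : GL (Fin 3) K ⧸ glInt 3 K) ∈
          MulAction.orbit (glInt 3 K) (((zpowDiagGL hϖ.ne_zero μ : GL (Fin 3) K)) : GL (Fin 3) K ⧸ glInt 3 K)}.ncard = 1 := by
  classical
  have hm := antitone_fin_three_iff.1 hμ
  have hlam : Antitone (μ + Pi.single 0 1 + Pi.single 1 1 : Fin 3 → ℤ) := antitone_fin_three_iff.2 (by simp; omega)
  rw [ncard_pieri_two_eq hϖ hlam hμ]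
  simp only [eq_sub_single_one_two_iff, eq_sub_single_zero_two_iff, eq_sub_single_zero_one_iff, Pi.add_apply, Pi.single_apply]
  simp

/-- `c_μ·T₂ ∋ c_{μ+e₀+e₂}` (`μ₂ + 1 ≤ μ₁`) with coefficient `q + [μ₁ = μ₂+1]`. [cite: Macdonald1995, Ch. II (4.6); Ch. V (2.6)] -/
theorem ncard_pieri_two_add_single_zero_two (hϖ : IsUniformizingElement ϖ) {μ : Fin 3 → ℤ} (hμ : Antitone μ) (h : μ 2 + 1 ≤ μ 1) :
    {γ ∈ MulAction.orbit (glInt 3 K) (((heckeDiag 3 (Units.mk0 ϖ hϖ.ne_zero) 2 : GL (Fin 3) K)) : GL (Fin 3) K ⧸ glInt 3 K) |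
        ((((γ.out)⁻¹ * zpowDiagGL hϖ.ne_zero (μ + Pi.single 0 1 + Pi.single 2 1) : GL (Fin 3) K)) : GL (Fin 3) K ⧸ glInt 3 K) ∈
          MulAction.orbit (glInt 3 K) (((zpowDiagGL hϖ.ne_zero μ : GL (Fin 3) K)) : GL (Fin 3) K ⧸ glInt 3 K)}.ncard =
      Nat.card 𝓀[K] + (if μ 1 = μ 2 + 1 then 1 else 0) := by
  classical
  have hm := antitone_fin_three_iff.1 hμ
  have hlam : Antitone (μ + Pi.single 0 1 + Pi.single 2 1 : Fin 3 → ℤ) := antitone_fin_three_iff.2 (by simp; omega)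
  rw [ncard_pieri_two_eq hϖ hlam hμ]
  simp only [eq_sub_single_one_two_iff, eq_sub_single_zero_two_iff, eq_sub_single_zero_one_iff, Pi.add_apply, Pi.single_apply]
  simp

/-- `c_μ·T₂ ∋ c_{μ+e₁+e₂}` (`μ₁ + 1 ≤ μ₀`) with coefficient `q² + [μ₀ = μ₁+1]·q + [μ₀ = μ₁+1 ∧ μ₁ = μ₂]`.
[cite: Macdonald1995, Ch. II (4.6); Ch. V (2.6)] -/
theorem ncard_pieri_two_add_single_one_two (hϖ : IsUniformizingElement ϖ) {μ : Fin 3 → ℤ} (hμ : Antitone μ) (h : μ 1 + 1 ≤ μ 0) :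
    {γ ∈ MulAction.orbit (glInt 3 K) (((heckeDiag 3 (Units.mk0 ϖ hϖ.ne_zero) 2 : GL (Fin 3) K)) : GL (Fin 3) K ⧸ glInt 3 K) |
        ((((γ.out)⁻¹ * zpowDiagGL hϖ.ne_zero (μ + Pi.single 1 1 + Pi.single 2 1) : GL (Fin 3) K)) : GL (Fin 3) K ⧸ glInt 3 K) ∈
          MulAction.orbit (glInt 3 K) (((zpowDiagGL hϖ.ne_zero μ : GL (Fin 3) K)) : GL (Fin 3) K ⧸ glInt 3 K)}.ncard =
      Nat.card 𝓀[K] ^ 2 + (if μ 0 = μ 1 + 1 then Nat.card 𝓀[K] else 0) + (if μ 0 = μ 1 + 1 ∧ μ 1 = μ 2 then 1 else 0) := by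
  classical
  have hm := antitone_fin_three_iff.1 hμ
  have hlam : Antitone (μ + Pi.single 1 1 + Pi.single 2 1 : Fin 3 → ℤ) := antitone_fin_three_iff.2 (by simp; omega)
  rw [ncard_pieri_two_eq hϖ hlam hμ]
  simp only [eq_sub_single_one_two_iff, eq_sub_single_zero_two_iff, eq_sub_single_zero_one_iff, Pi.add_apply, Pi.single_apply]
  simp

/-- **VANISHING, `r = 2`**: for antitone `λ ∉ {μ+e₀+e₁, μ+e₀+e₂, μ+e₁+e₂}` the coefficient of `c_λ` in `c_μ·T₂` is `0`.
[cite: Macdonald1995, Ch. II (4.4)–(4.6)] -/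
theorem ncard_pieri_two_eq_zero (hϖ : IsUniformizingElement ϖ) {lam μ : Fin 3 → ℤ} (hlam : Antitone lam) (hμ : Antitone μ)
    (h01 : lam ≠ μ + Pi.single 0 1 + Pi.single 1 1) (h02 : lam ≠ μ + Pi.single 0 1 + Pi.single 2 1)
    (h12 : lam ≠ μ + Pi.single 1 1 + Pi.single 2 1) :
    {γ ∈ MulAction.orbit (glInt 3 K) (((heckeDiag 3 (Units.mk0 ϖ hϖ.ne_zero) 2 : GL (Fin 3) K)) : GL (Fin 3) K ⧸ glInt 3 K) |
        ((((γ.out)⁻¹ * zpowDiagGL hϖ.ne_zero lam : GL (Fin 3) K)) : GL (Fin 3) K ⧸ glInt 3 K) ∈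
          MulAction.orbit (glInt 3 K) (((zpowDiagGL hϖ.ne_zero μ : GL (Fin 3) K)) : GL (Fin 3) K ⧸ glInt 3 K)}.ncard = 0 := by
  classical
  rw [ncard_pieri_two_eq hϖ hlam hμ, if_neg (fun h => h12 (by rw [h]; abel)), if_neg (fun h => h02 (by rw [h]; abel)),
    if_neg (fun h => h01 (by rw [h]; abel))]

end Tables

end Summit.HodgeConjecture.HodgeConjecture.R90.S6
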